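import Summits.QuantumFields.BalabanUV.Beta.FP.RemainderSymbolSliceNBound
import Summits.QuantumFields.BalabanUV.Beta.FP.PerfectSymbolDerivN
import Summits.QuantumFields.BalabanUV.Beta.FP.PerfectPropagatorRemainderSymbol

/-!
# `BalabanUV.Beta.FP.PerfectPropagatorRemainderSymbolN` — road «FP» for binder row D1, leaf H2-P of the horizontal route, sub-row H2-P-CHAIN-N (owner
# assignment 2026-08-20, R-FP-21 (B2); routing F-FP-5-1 «route KER-ASM through CHAIN-N»), PART 3c: THE CONTINUUM-WEIGHT INSTANCE.  At the weights
# `wInf μ ν p = Re W_∞(μ,ν; p)` of the unconstrained perfect propagator, on every zone slice missing the origin, the remainder symbol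
# `B = PinfSym − 𝟙∕|p̂|²` has a derivative chain of EVERY length with NO displayed regularity row:
# `(remSlN wInf s i α β n)′ = remSlN … (n+1)` (`n < N`) and `‖remSlN wInf s i α β n t‖ ≤ KremP N n d ∕ ‖p‖ⁿ` (`n ≤ N`), `p = update s i t`.

HONEST DEPENDENCY (page 1, mandatory): continuum YM on T⁴ ⇐ BetaPertH ∧ nine spine estimates (0/9 proved); BetaPertH ⇐ (D1) ∧ (D4) ∧ CAP+tail;
G-an2-4 gates asym, D1 and NE2/3/4.  HONEST FRAMING (cell contract, verbatim): «discharging `BetaPertH` makes Bałaban's UV stability UNCONDITIONAL —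
a real constructive-QFT result; it is NOT the continuum limit and NOT the Clay problem.»  THIS MODULE DISCHARGES NOTHING of the wall: it INSTANTIATES, by
name, `FP/RemainderSymbolSliceN.hasDerivAt_remSlN` and `FP/RemainderSymbolSliceNBound.norm_remSlN_le` (this lineage) with the local regularity and the
graded letters of `FP/PerfectSymbolDerivN` (gan24-p3-g16: `contDiffOn_perfect_feyn_entryN`, `contDiffOn_perfect_excess_entryN`, `graded_perfect_feyn_entryN`,
`graded_perfect_excess_entryN`, constants `KAPN`, `KRPN`) and the invertibility ∕ coercivity rows of `FP/PerfectPropagatorRemainderSymbol` (gan24-formalise-leaf-05-g34: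
`hdet_wInf`, `hinv_wInf`, `slicePt`, `remSl0_wInf_eq`); the heavy inputs behind those (H2-P-BND, W166-HOLO (D)/(E)/(E v1.1), W166-FLAT, H2-P-INV-N) are cited
there.  0 `def … : Prop`; nothing cited; 0 sorry; 0 wall binders; NOT D1, NOT BetaPertH, NOT continuum, NOT Clay.

ABSOLUTE RULE (cell charter, verbatim): «No internally-minted statement may enter as a cited fact. Every hypothesis is either kernel-proved in this package or a
verbatim quotation of a PUBLISHED theorem with page reference. The manuscript(s) under audit are NOT citable for their own disputed steps — they are the thing
under adjudication; programme-internal (2001/route/tribunal) claims are never citable.»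

WHY (owner finding F-FP-5-1).  The order-3 instance `PerfectPropagatorRemainderSymbol.norm_remSl_wInf_le` displays a GLOBAL slice-`C³` row `hwC` that the
Lean object `W166Inf ∘ ofRealVec` cannot satisfy (it is discontinuous at real momenta with a coordinate in `2πℤ ∖ {0}`); H2-P-KER-ASM is therefore routed through
the LOCAL chain.  Here every hypothesis is a zone fact: `s ∈ BZ (d+1)`, `i.removeNth s ≠ 0`, `t ∈ [−π, π]`.

WHAT (`wInf` = leaf-05-g34's reducible abbreviation; `p := update s i t`; `remSlN` = `RemainderSymbolSliceN.remSlN`; every `N n : ℕ` free).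
* `remSlN_wInf_zero_eq` — order zero IS the row's `B`: `remSlN wInf s i α β 0 t = PinfSym p (p̂ p) α β − [α = β]∕Σ‖p̂ p‖²`.
* **`hasDerivAt_remSlN_wInf`** — `n < N ⟹ HasDerivAt (remSlN wInf s i α β n) (remSlN wInf s i α β (n+1) t) t` (the `hder` data of `PuncturedCoordDeriv`
  at every length, in `update` currency; `RemainderSymbolSlice.update_eq_insertNth` converts to `insertNth` currency).
* `c0P d := (d+1)·(π²∕4)^{d+4}` (op-norm coercivity constant from `hinv_wInf` via `InverseRate.norm_le_card_mul`), `KAPN_nonneg`,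
  **`KremP N n d := Krem N n (c0P d) (KAPN N d) (KRPN N d) d`** and **`norm_remSlN_wInf_le`**: `∀ n ≤ N, ‖remSlN wInf s i α β n t‖ ≤ KremP N n d ∕ ‖update s i t‖ⁿ`
  — `∂_tⁿ B = O(‖p‖^{−n})` on the punctured zone at EVERY order, the letters H2-P-KER-ASM v1 ((K1), n ≤ 3) and v1.1 ((K2)/(K3), n ≤ 5) integrate.

Provenance: binder row D1 formalisation swarm, lineage beta-d1-formalise-leaf-01, gen 8 (prover-b2b-balaban-beta-d1-formalise-leaf-01-g8-0), 2026-08-20;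
sub-row H2-P-CHAIN-N of road FP (owner b2b-balaban-beta-d1-p3, GO l.21478, routing F-FP-5-1 l.21879).
-/

noncomputable section

namespace Summit.QuantumFields.BalabanUV.Beta.FP.PerfectPropagatorRemainderSymbolN

open Complex Finset Set Filter Matrix
open scoped Matrix.Norms.Operator BigOperators ComplexConjugate Topology
open Literature.MathematicalPhysics.QuantumFieldTheory.Balaban1983to89
open B4Strip (ofRealVec)
open B4ContourShift (BZ)
open B5Prop11Fiber (d1Sym)
open Summit.QuantumFields.BalabanUV.Beta.FP.PerfectSymbol166 (W166Inf)
open Summit.QuantumFields.BalabanUV.Beta.FP.PerfectPropagatorSymbol (feynMat PinfSym maxwellMat)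
open Summit.QuantumFields.BalabanUV.Beta.FP.PerfectSymbol166StripReg (delta166 delta166_pos)
open Summit.QuantumFields.BalabanUV.Beta.FP.RemainderSymbolSlice (excSl excSl_update)
open Summit.QuantumFields.BalabanUV.Beta.FP.RemainderSymbolSliceN (feynC remSlN remSlN_zero_eq_remSl0 hasDerivAt_remSlN)
open Summit.QuantumFields.BalabanUV.Beta.FP.RemainderSymbolSliceNBound (Krem norm_remSlN_le)
open Summit.QuantumFields.BalabanUV.Beta.FP.PerfectSymbolDeriv (apply_mem_Ioo norm_le_pi_of_mem_BZ)
open Summit.QuantumFields.BalabanUV.Beta.FP.PerfectSymbolDerivN (KAPN KRPN cwPN_nonneg contDiffOn_perfect_feyn_entryN contDiffOn_perfect_excess_entryN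
  graded_perfect_feyn_entryN graded_perfect_excess_entryN)
open Summit.QuantumFields.BalabanUV.Beta.FP.PerfectPropagatorRemainderSymbol (wInf slicePt hdet_wInf hinv_wInf remSl0_wInf_eq)
open Summit.QuantumFields.BalabanUV.Beta.GAN24.InverseRate (norm_le_card_mul)

variable {d : ℕ}

/-! ## §1 Order zero and base-point bookkeeping -/

/-- [our object] **ORDER ZERO IS THE ROW's `B`** at the continuum weights: `remSlN wInf s i α β 0 t = PinfSym p (p̂ p) α β − [α = β]∕Σ_a ‖p̂_a(p)‖²`. -/
theorem remSlN_wInf_zero_eq {s : Fin (d + 1) → ℝ} {i : Fin (d + 1)} {t : ℝ} (ht : t ∈ Icc (-Real.pi) Real.pi)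
    (hq : i.removeNth s ∈ BZ d) (hq0 : i.removeNth s ≠ 0) (α β : Fin (d + 1)) :
    remSlN (wInf (d := d)) s i α β 0 t
      = PinfSym (Function.update s i t) (d1Sym (Function.update s i t)) α β
        - (if α = β then ((((∑ a, ‖d1Sym (Function.update s i t) a‖ ^ 2 : ℝ))⁻¹ : ℝ) : ℂ) else 0) := by
  rw [remSlN_zero_eq_remSl0]
  exact remSl0_wInf_eq ht hq hq0 α β

/-- [folklore] the slice through `update s i t` in direction `i` is the slice through `s` (as functions of the running coordinate). -/
theorem slice_fun_update {E : Type*} (G : (Fin (d + 1) → ℝ) → E) (s : Fin (d + 1) → ℝ) (i : Fin (d + 1)) (t : ℝ) :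
    (fun u : ℝ => G (Function.update (Function.update s i t) i u)) = fun u : ℝ => G (Function.update s i u) := by
  funext u; rw [Function.update_idem]

/-! ## §2 The chain at the continuum weights, every order -/

/-- [our object] **THE CHAIN AT `Re W_∞`, EVERY ORDER, NO DISPLAYED REGULARITY ROW**: for `s ∈ BZ (d+1)`, `i.removeNth s ≠ 0`, `t ∈ [−π, π]` and `n < N`,
`(remSlN wInf s i α β n)′(t) = remSlN wInf s i α β (n+1) t`. -/
theorem hasDerivAt_remSlN_wInf (N : ℕ) {s : Fin (d + 1) → ℝ} {i : Fin (d + 1)} {t : ℝ} (hs : s ∈ BZ (d + 1)) (ht : t ∈ Icc (-Real.pi) Real.pi)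
    (hq0 : i.removeNth s ≠ 0) {n : ℕ} (hn : n < N) (α β : Fin (d + 1)) :
    HasDerivAt (remSlN (wInf (d := d)) s i α β n) (remSlN (wInf (d := d)) s i α β (n + 1) t) t := by
  have hq : i.removeNth s ∈ BZ d := PerfectSymbol166RealLineRe.removeNth_mem_BZ i hs
  obtain ⟨hpBZ, hp0⟩ := slicePt ht hq hq0 (s := s) (i := i)
  have hU : IsOpen (Ioo (-(Real.pi + delta166 (d + 1))) (Real.pi + delta166 (d + 1))) := isOpen_Ioo
  have htU : t ∈ Ioo (-(Real.pi + delta166 (d + 1))) (Real.pi + delta166 (d + 1)) := by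
    have h := apply_mem_Ioo hpBZ i
    rwa [Function.update_self] at h
  have hfeyn : ∀ γ β', ContDiffAt ℝ N (fun u : ℝ => feynMat (fun μ ν => wInf μ ν (Function.update s i u)) (d1Sym (Function.update s i u)) γ β') t :=
    fun γ β' => (contDiffOn_perfect_feyn_entryN N hs i γ β').contDiffAt (hU.mem_nhds htU)
  have hexc : ∀ γ β', ContDiffAt ℝ N
      (fun u : ℝ => maxwellMat (fun μ ν => wInf μ ν (Function.update s i u) - 1) (d1Sym (Function.update s i u)) γ β') t :=
    fun γ β' => (contDiffOn_perfect_excess_entryN N hs i γ β').contDiffAt (hU.mem_nhds htU)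
  have hdet : IsUnit (feynC (wInf (d := d)) s i t).det := by
    unfold feynC; exact hdet_wInf _ hpBZ hp0
  exact hasDerivAt_remSlN hfeyn hexc hdet hq hq0 hn α β

/-! ## §3 The letters at the continuum weights, every order -/

/-- [our object] the op-norm coercivity constant: `c0P d := (d+1)·(π²∕4)^{d+4}`. -/
def c0P (d : ℕ) : ℝ := ((d : ℝ) + 1) * (Real.pi ^ 2 / 4) ^ (d + 1 + 3)

/-- [folklore] `0 ≤ KAPN N d`. -/
theorem KAPN_nonneg (N d : ℕ) : 0 ≤ KAPN N d := by
  unfold KAPN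
  have := cwPN_nonneg N d
  positivity

/-- [our object] **THE LETTER CONSTANT OF THE PERFECT REMAINDER SYMBOL at order `n ≤ N`**: `KremP N n d := Krem N n (c0P d) (KAPN N d) (KRPN N d) d`. -/
def KremP (N n d : ℕ) : ℝ := Krem N n (c0P d) (KAPN N d) (KRPN N d) d

/-- [our object] the op-norm coercive-inverse row at `Re W_∞`: `‖(feynC wInf s i t)⁻¹‖ ≤ c0P d ∕ ‖update s i t‖²` (entry row `hinv_wInf` × `card`). -/
theorem norm_feynC_inv_wInf_le {s : Fin (d + 1) → ℝ} {i : Fin (d + 1)} {t : ℝ} (hpBZ : Function.update s i t ∈ BZ (d + 1))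
    (hp0 : Function.update s i t ≠ 0) :
    ‖(feynC (wInf (d := d)) s i t)⁻¹‖ ≤ c0P d / ‖Function.update s i t‖ ^ 2 := by
  have h := norm_le_card_mul ((feynC (wInf (d := d)) s i t)⁻¹) (c := (Real.pi ^ 2 / 4) ^ (d + 1 + 3) / ‖Function.update s i t‖ ^ 2)
    (by positivity) (fun α β => hinv_wInf _ hpBZ hp0 α β)
  rw [Fintype.card_fin] at h
  push_cast at h
  refine h.trans (le_of_eq ?_)
  unfold c0P; ring

/-- [our object] **THE LETTERS AT `Re W_∞`, EVERY ORDER, NO DISPLAYED REGULARITY ROW**: for `s ∈ BZ (d+1)`, `i.removeNth s ≠ 0`, `t ∈ [−π, π]`: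
`∀ n ≤ N, ‖remSlN wInf s i α β n t‖ ≤ KremP N n d ∕ ‖update s i t‖ⁿ` — `∂_tⁿ B(p) = O(‖p‖^{−n})` on the punctured zone. -/
theorem norm_remSlN_wInf_le (N : ℕ) {s : Fin (d + 1) → ℝ} {i : Fin (d + 1)} {t : ℝ} (hs : s ∈ BZ (d + 1)) (ht : t ∈ Icc (-Real.pi) Real.pi)
    (hq0 : i.removeNth s ≠ 0) {n : ℕ} (hn : n ≤ N) (α β : Fin (d + 1)) :
    ‖remSlN (wInf (d := d)) s i α β n t‖ ≤ KremP N n d / ‖Function.update s i t‖ ^ n := by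
  have hq : i.removeNth s ∈ BZ d := PerfectSymbol166RealLineRe.removeNth_mem_BZ i hs
  obtain ⟨hpBZ, hp0⟩ := slicePt ht hq hq0 (s := s) (i := i)
  set p : Fin (d + 1) → ℝ := Function.update s i t with hp
  have hU : IsOpen (Ioo (-(Real.pi + delta166 (d + 1))) (Real.pi + delta166 (d + 1))) := isOpen_Ioo
  have htU : t ∈ Ioo (-(Real.pi + delta166 (d + 1))) (Real.pi + delta166 (d + 1)) := by
    have h := apply_mem_Ioo hpBZ i
    rwa [hp, Function.update_self] at h
  have hpi : p i = t := by rw [hp, Function.update_self]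
  -- the entry regularity at `t`
  have hfeyn : ∀ γ β', ContDiffAt ℝ N (fun u : ℝ => feynMat (fun μ ν => wInf μ ν (Function.update s i u)) (d1Sym (Function.update s i u)) γ β') t :=
    fun γ β' => (contDiffOn_perfect_feyn_entryN N hs i γ β').contDiffAt (hU.mem_nhds htU)
  -- the Feynman entry letters at `t`, read at the base point `p` (slice through `p` = slice through `s`, `p i = t`)
  have hF : ∀ k, 1 ≤ k → k ≤ N → ∀ γ β', ‖iteratedDeriv k (fun u => feynC (wInf (d := d)) s i u γ β') t‖ ≤ KAPN N d * ‖p‖ ^ (2 - k) := by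
    intro k _ hk γ β'
    have h := graded_perfect_feyn_entryN N hpBZ i γ β' k hk
    rw [slice_fun_update (fun x => feynMat (fun μ ν => (W166Inf μ ν (ofRealVec x)).re) (d1Sym x) γ β') s i t, hpi] at h
    exact h
  have hE : ∀ k ≤ N, ∀ γ β', ‖excSl (wInf (d := d)) s i k t γ β'‖ ≤ KRPN N d * ‖p‖ ^ (4 - k) := by
    intro k hk γ β'
    have h := graded_perfect_excess_entryN N hpBZ i γ β' k hk
    rw [slice_fun_update (fun x => maxwellMat (fun μ ν => (W166Inf μ ν (ofRealVec x)).re - 1) (d1Sym x) γ β') s i t, hpi] at h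
    exact h
  have hdet : IsUnit (feynC (wInf (d := d)) s i t).det := by
    unfold feynC; exact hdet_wInf _ hpBZ hp0
  exact norm_remSlN_le hfeyn hdet ht hq hq0 (norm_feynC_inv_wInf_le hpBZ hp0) (KAPN_nonneg N d) hF hE hn α β

end Summit.QuantumFields.BalabanUV.Beta.FP.PerfectPropagatorRemainderSymbolN

end
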